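import Summits.QuantumFields.BalabanUV.Beta.SymCorrectorKernel
import Summits.QuantumFields.BalabanUV.Beta.KernelWardRelative

/-!
# `BalabanUV.Beta.SymCorrectorFace` — binder row D1, road «BF-x» junction (J1), the `Δ_n` Ward program (an2 R-D1-g43-3 (2)), brick TT3a = W-3′ (i) of the OWNER's
# `HOME/b2b-balaban-beta-d1-p2/J1-DEFECT-WORDS.md` v0.1: **THE FACE FORMULA OF THE SYMMETRISED CORRECTOR AND THE SLOT TRANSPORT `Ψ_Sᵀ`** —
#   `Ψ̂_S u x (inl κ′) (inl α) = [κ′ = α ∧ u = x] + faceWt α x · gaugeWt n (blk x) κ′ u`,  `faceWt r n α x := |box n|⁻¹ · ζ_S(e_{(α,x)})(blk n x)`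
# (`Ψ̂_S − 1` couples the slot bond `(α, x)` only to the fine bonds `(κ′, u)` CROSSING the face `∂B(x)` of its block, with ONE scalar weight per slot bond; a face-crossing slot bond
# carries no weight), and the finite FACE SUM it induces on bond families: [our objects] `faceSum n T Y := Σ_{κ′} Σ_{u ∈ bondNbhd n Y κ′} gaugeWt n Y κ′ u • T κ′ u` (entering minus leaving
# bonds of the block `Y`) and `slotPsiS r n T α x := T α x + faceWt α x • faceSum n T (blk n x)`
# (`= T + T^face`, the words file's `S + S^face`), with **`Σ_{κ′} Σ'_u (Ψ_S e_{(α,x)})_{κ′}(u) · T κ′ u = slotPsiS T α x`** (every series a finite sum).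
# `Ψ̂_S = psiKS r n` (TT2a `SymCorrectorKernel`), any in-block root offset `r ∈ box (d+1) n` (chart of record: `r = ctrOff (d+1) n`).  TT3b `SymCorrectorSlot` turns this into the leg
# actions `Ψ̂_Sᵀ ∘ X`, `X ∘ Ψ̂_S` and THE SLOT ADJUNCTION `vertexOfK (Ψ̂_S∘K∘Ψ̂_Sᵀ) n S = vertexOfK K n (slotPsiS S)`.

HOW ([folklore]).  TT1's `corrPsiS_apply` on a bond indicator plus LOCALITY `depOn_zetaS` (`ζ_S(e_{(α,x)})(Y) = 0` unless `(α,x)` is an in-block bond of `Y`); the support of an1's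
`KernelWardRelative.gaugeWt n Y κ′` inside the `Finset` `bondNbhd n Y κ′` (leaf-06 g32's `blockSitesF` and its `−e_κ′` translate), whence `tsum → Finset.sum`; block-translation
covariance `faceWt_shift` (`zetaS_shift`, `blk_add_zsmul`) gives the uniform bound `|faceWt| ≤ faceWtSum` (a finite table over `box`).

HONEST FRAMING (cell contract, verbatim): «discharging `BetaPertH` makes Bałaban's UV stability UNCONDITIONAL — a real constructive-QFT result; it
is NOT the continuum limit and NOT the Clay problem.»  HONEST DEPENDENCY (verbatim): «continuum YM on T⁴ ⇐ BetaPertH ∧ nine spine estimates (0/9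
proved); BetaPertH ⇐ (D1) ∧ (D4) ∧ CAP+tail; G-an2-4 gates asym, D1 and NE2/3/4.»
ABSOLUTE RULE (cell, verbatim): «No internally-minted statement may enter as a cited fact. Every hypothesis is either kernel-proved in this package or a
verbatim quotation of a PUBLISHED theorem with page reference. The manuscript(s) under audit are NOT citable for their own disputed steps — they are the
thing under adjudication; programme-internal (2001/route/tribunal) claims are never citable.»  NOTHING is cited; five DATA definitions ([our object] `faceWt`, `faceWtSum`, `bondNbhd`,
`faceSum`, `slotPsiS`) and [folklore] finite-sum bookkeeping over the cell's OWN typed objects BY NAME.  It asserts nothing about Bałaban's non-linear averages; it prices NO row of (J1); discharges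
NOTHING of (K), of hW ∕ hR ∕ D1Tel ∕ D1Rep (0∕4), of D1 or of BetaPertH; NOT continuum, NOT Clay.

CONTENT ([folklore]; `d+1` the lattice dimension, `0 < n`, `r ∈ box (d+1) n`, `ρ = toSite r`):
§1 `b6unitVec_eq`, `gaugeWt_eq`, `zetaS_indR_eq_zero_of_not_mem ∕ _of_blk_ne`, [our object] `faceWt`, **`corrPsiS_indR_apply`**, **`psiKS_inl_inl_eq`** (the face formula),
   `faceWt_eq_zero_of_blk_ne`, `faceWt_shift`, [our object] `faceWtSum`, `faceWtSum_nonneg`, `abs_faceWt_le`.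
§2 [our object] `bondNbhd`, `mem_bondNbhd_of_gaugeWt_ne_zero`, `gaugeWt_eq_zero_of_not_mem`, `tsum_gaugeWt_mul`, `card_blockSitesF`, `card_bondNbhd_le`, `l1_le_of_mem_bondNbhd`;
   [our objects] `faceSum` (`faceSum_apply ∕ _eq_sum_sigma ∕ _zero ∕ _apply_kernel`), `slotPsiS` (module-valued: scalar and stencil families at once), `slotPsiS_apply ∕ _block ∕ _zero ∕ _apply_kernel`,
   `corrPsiS_indR_eq_zero_of_not_mem`,
   **`sum_tsum_corrPsiS_indR_mul`**; covariance `gaugeWt_add_block`, `faceSum_shift`, **`slotPsiS_shift`** (block-covariant families transport to block-covariant families).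
Provenance: D1 formalisation swarm, unit `b2b-balaban-beta-d1-formalise-leaf-03` (gen 29), 2026-08-23; over TT1∕TT2a (leaf-03 g28), an1's `KernelWardRelative.gaugeWt`, leaf-06 g32's
`CompositeCorrectorLocality` BY NAME; no existing file touched.
-/

namespace Summit.QuantumFields.BalabanUV.Beta.SymCorrectorFace

open Finset
open scoped BigOperators
open Literature.MathematicalPhysics.QuantumFieldTheory
open Literature.MathematicalPhysics.QuantumFieldTheory.Balaban1983to89
open Literature.MathematicalPhysics.QuantumFieldTheory.Balaban1983to89.Beta
open B12Sec2to5 (l1 l1_nonneg)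
open ExpKernelCalculus (MKer shiftK)
open OneStepResolventKernel (Fib)
open AffineAveraging (Site Form1 box toSite unitVec unitVec_apply)
open AveragingContours (blk blk_block blk_add_off off off_mem_box shift)
open AxialProjector (blk_add_zsmul)
open Summit.QuantumFields.BalabanUV.Beta.KernelWardRelative (gaugeWt)
open Summit.QuantumFields.BalabanUV.Beta.SymCorrectorForms (zetaS zetaS_zero zetaS_shift corrPsiS corrPsiS_apply depOn_zetaS)
open Summit.QuantumFields.BalabanUV.Beta.SymCorrectorKernel (psiKS psiKS_inl_inl)
open Summit.QuantumFields.BalabanUV.Beta.CompositeCorrectorLocality (InBlockBond mem_inBlockBond blockSitesF mem_blockSitesF_of_blk_eq le_of_blk lt_of_blk)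
open Summit.QuantumFields.BalabanUV.Beta.CompositeCorrectorKernel (indR indR_apply)

noncomputable section

variable {d : ℕ}

/-! ## §1 The face formula for `Ψ̂_S` -/

/-- [folklore] The two unit-vector conventions of the tree agree (`KernelWardRelative.gaugeWt` uses an2's `B6BondElimination.unitVec`, TT1 uses an1's `AffineAveraging.unitVec`). -/
theorem b6unitVec_eq (κ : Fin (d + 1)) : (B6BondElimination.unitVec κ : Fin (d + 1) → ℤ) = unitVec κ := by
  funext i
  simp only [B6BondElimination.unitVec, AffineAveraging.unitVec, Pi.single_apply]

/-- [folklore] `gaugeWt` unfolded in the `AffineAveraging.unitVec` convention. -/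
theorem gaugeWt_eq (n : ℕ) (Y : Site (d + 1)) (κ' : Fin (d + 1)) (u : Site (d + 1)) :
    gaugeWt n Y κ' u = (if blk n (u + unitVec κ') = Y then 1 else 0) - (if blk n u = Y then 1 else 0) := by
  rw [gaugeWt, b6unitVec_eq]

section Face

variable {n : ℕ} (hn : 0 < n) {r : Fin (d + 1) → ℕ} (hr : r ∈ box (d + 1) n)
include hn hr

/-- [folklore] **`ζ_S` OF A BOND INDICATOR IS SUPPORTED AT THE BLOCK OF THE BOND**: if `(α, x)` is not an in-block bond of the `n`-block `Y`, then `ζ_S(e_{(α,x)})(Y) = 0`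
(TT1's locality `depOn_zetaS`). -/
theorem zetaS_indR_eq_zero_of_not_mem {α : Fin (d + 1)} {x Y : Site (d + 1)} (h : (α, x) ∉ InBlockBond n Y) :
    zetaS (toSite r) n (indR α x) Y = 0 := by
  have e : zetaS (toSite r) n (indR α x) Y = zetaS (toSite r) n 0 Y :=
    (depOn_zetaS hn hr Y).eq fun κ y hp => by
      rw [indR_apply]
      by_cases hκ : κ = α ∧ y = x
      · obtain ⟨rfl, rfl⟩ := hκ
        exact absurd hp h
      · rw [if_neg hκ]; rfl
  rw [e, zetaS_zero]; rfl

/-- [folklore] In particular `ζ_S(e_{(α,x)})(Y) = 0` for every block `Y ≠ blk n x`. -/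
theorem zetaS_indR_of_blk_ne (α : Fin (d + 1)) {x Y : Site (d + 1)} (h : blk n x ≠ Y) : zetaS (toSite r) n (indR α x) Y = 0 :=
  zetaS_indR_eq_zero_of_not_mem hn hr fun hp => h (mem_inBlockBond.1 hp).1

end Face

/-- [our object] **THE FACE WEIGHT OF THE SLOT BOND `(α, x)`**: `faceWt r n α x := |box n|⁻¹ · ζ_S(e_{(α,x)})(blk n x)` — the one scalar by which `Ψ̂_S − 1` couples the slot bond to the
bonds crossing the face of its block (`= |box n|⁻¹·(d!)⁻¹·colG` for an interior bond in an1's `DshAn1` count; `0` for a face-crossing bond). -/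
def faceWt (r : Fin (d + 1) → ℕ) (n : ℕ) (α : Fin (d + 1)) (x : Site (d + 1)) : ℝ :=
  ((box (d + 1) n).card : ℝ)⁻¹ * zetaS (toSite r) n (indR α x) (blk n x)

section FaceFormula

variable {n : ℕ} (hn : 0 < n) {r : Fin (d + 1) → ℕ} (hr : r ∈ box (d + 1) n)
include hn hr

/-- [folklore] **THE FACE FORMULA (Form level)**: `(Ψ_S e_{(α,x)})_{κ′}(u) = δ_{(κ′,u),(α,x)} + faceWt α x · gaugeWt n (blk x) κ′ u`. -/
theorem corrPsiS_indR_apply (α : Fin (d + 1)) (x : Site (d + 1)) (κ' : Fin (d + 1)) (u : Site (d + 1)) :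
    corrPsiS (toSite r) n (indR α x) κ' u = indR α x κ' u + faceWt r n α x * gaugeWt n (blk n x) κ' u := by
  classical
  have hz : ∀ Y, zetaS (toSite r) n (indR α x) Y = if Y = blk n x then zetaS (toSite r) n (indR α x) (blk n x) else 0 := by
    intro Y
    split_ifs with h
    · rw [h]
    · exact zetaS_indR_of_blk_ne hn hr α (Ne.symm h)
  rw [corrPsiS_apply, hz (blk n (u + unitVec κ')), hz (blk n u), faceWt, gaugeWt_eq]
  split_ifs <;> ring

/-- [folklore] **THE FACE FORMULA (kernel level)**: `Ψ̂_S u x (inl κ′) (inl α) = [κ′ = α ∧ u = x] + faceWt α x · gaugeWt n (blk x) κ′ u` — `Ψ̂_S − 1` lives on the fine bonds CROSSING `∂B(x)`. -/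
theorem psiKS_inl_inl_eq (u x : Site (d + 1)) (κ' α : Fin (d + 1)) :
    psiKS r n u x (Sum.inl κ') (Sum.inl α) = (if κ' = α ∧ u = x then 1 else 0) + faceWt r n α x * gaugeWt n (blk n x) κ' u := by
  rw [psiKS_inl_inl, corrPsiS_indR_apply hn hr, indR_apply]

/-- [folklore] **A FACE-CROSSING SLOT BOND CARRIES NO WEIGHT**: `blk n (x + e_α) ≠ blk n x ⟹ faceWt α x = 0`. -/
theorem faceWt_eq_zero_of_blk_ne {α : Fin (d + 1)} {x : Site (d + 1)} (h : blk n (x + unitVec α) ≠ blk n x) : faceWt r n α x = 0 := by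
  rw [faceWt, zetaS_indR_eq_zero_of_not_mem hn hr (fun hp => h (mem_inBlockBond.1 hp).2), mul_zero]

omit hr in
/-- [folklore] **BLOCK-TRANSLATION COVARIANCE OF THE FACE WEIGHT**: `faceWt α (x + n•v) = faceWt α x` (`zetaS_shift`, `blk_add_zsmul`). -/
theorem faceWt_shift (r : Fin (d + 1) → ℕ) (α : Fin (d + 1)) (x v : Site (d + 1)) : faceWt r n α (x + (n : ℤ) • v) = faceWt r n α x := by
  have e : indR α (x + (n : ℤ) • v) = shift ((n : ℤ) • (-v)) (indR α x) := by
    funext κ z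
    simp only [shift, indR_apply, smul_neg]
    have : (z = x + (n : ℤ) • v) ↔ (z + -((n : ℤ) • v) = x) := by
      constructor
      · intro h; rw [h]; abel
      · intro h; rw [← h]; abel
    simp only [this]
  rw [faceWt, faceWt, e, zetaS_shift, blk_add_zsmul hn]
  simp only [add_neg_cancel_right]

end FaceFormula

/-- [our object] **THE FINITE TABLE OF FACE WEIGHTS, SUMMED**: `faceWtSum r n := Σ_α Σ_{b ∈ box} |faceWt r n α b|` — a uniform bound for `|faceWt r n α x|` (block covariance). -/
def faceWtSum (r : Fin (d + 1) → ℕ) (n : ℕ) : ℝ := ∑ α : Fin (d + 1), ∑ b ∈ box (d + 1) n, |faceWt r n α (toSite b)|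

/-- [folklore] `0 ≤ faceWtSum r n`. -/
theorem faceWtSum_nonneg (r : Fin (d + 1) → ℕ) (n : ℕ) : 0 ≤ faceWtSum r n :=
  Finset.sum_nonneg fun _ _ => Finset.sum_nonneg fun _ _ => abs_nonneg _

/-- [folklore] **UNIFORM BOUND ON THE FACE WEIGHT**: `|faceWt r n α x| ≤ faceWtSum r n` (`x = n•blk x + off x`, `faceWt_shift`). -/
theorem abs_faceWt_le {n : ℕ} (hn : 0 < n) (r : Fin (d + 1) → ℕ) (α : Fin (d + 1)) (x : Site (d + 1)) : |faceWt r n α x| ≤ faceWtSum r n := by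
  have hx : x = toSite (off n x) + (n : ℤ) • blk n x := by rw [add_comm (toSite (off n x)), blk_add_off hn]
  rw [hx, faceWt_shift hn]
  calc |faceWt r n α (toSite (off n x))| ≤ ∑ b ∈ box (d + 1) n, |faceWt r n α (toSite b)| :=
        Finset.single_le_sum (f := fun b => |faceWt r n α (toSite b)|) (fun _ _ => abs_nonneg _) (off_mem_box hn x)
    _ ≤ faceWtSum r n :=
        Finset.single_le_sum (f := fun α' => ∑ b ∈ box (d + 1) n, |faceWt r n α' (toSite b)|)
          (fun _ _ => Finset.sum_nonneg fun _ _ => abs_nonneg _) (Finset.mem_univ α)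

/-! ## §2 The face neighbourhood and the slot transport `slotPsiS` -/

/-- [our object] **THE FACE NEIGHBOURHOOD** of the `n`-block `Y` in direction `κ′`: the sites of the block together with their `−e_κ′` translates — a `Finset` containing every `u`
with `gaugeWt n Y κ′ u ≠ 0` (a fine bond `(κ′, u)` touching the block). -/
def bondNbhd (n : ℕ) (Y : Site (d + 1)) (κ' : Fin (d + 1)) : Finset (Site (d + 1)) :=
  blockSitesF n Y ∪ (blockSitesF n Y).image fun u => u - unitVec κ'

section Nbhd

variable {n : ℕ} (hn : 0 < n)
include hn

/-- [folklore] The support of `gaugeWt n Y κ′` lies in `bondNbhd n Y κ′`. -/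
theorem mem_bondNbhd_of_gaugeWt_ne_zero {Y u : Site (d + 1)} {κ' : Fin (d + 1)} (h : gaugeWt n Y κ' u ≠ 0) : u ∈ bondNbhd n Y κ' := by
  classical
  rw [bondNbhd, Finset.mem_union, Finset.mem_image]
  by_cases h1 : blk n u = Y
  · exact Or.inl (mem_blockSitesF_of_blk_eq hn h1)
  by_cases h2 : blk n (u + unitVec κ') = Y
  · exact Or.inr ⟨u + unitVec κ', mem_blockSitesF_of_blk_eq hn h2, add_sub_cancel_right _ _⟩
  exfalso; apply h
  rw [gaugeWt_eq, if_neg h2, if_neg h1, sub_zero]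

/-- [folklore] `gaugeWt n Y κ′ u = 0` off `bondNbhd n Y κ′`. -/
theorem gaugeWt_eq_zero_of_not_mem {Y u : Site (d + 1)} {κ' : Fin (d + 1)} (h : u ∉ bondNbhd n Y κ') : gaugeWt n Y κ' u = 0 := by
  by_contra h'
  exact h (mem_bondNbhd_of_gaugeWt_ne_zero hn h')

/-- [folklore] **A `gaugeWt`-weighted lattice sum is a finite face sum**: `Σ'_u gaugeWt n Y κ′ u · g u = Σ_{u ∈ bondNbhd n Y κ′} gaugeWt n Y κ′ u · g u`. -/
theorem tsum_gaugeWt_mul (Y : Site (d + 1)) (κ' : Fin (d + 1)) (g : Site (d + 1) → ℝ) :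
    ∑' u, gaugeWt n Y κ' u * g u = ∑ u ∈ bondNbhd n Y κ', gaugeWt n Y κ' u * g u :=
  tsum_eq_sum fun u hu => by rw [gaugeWt_eq_zero_of_not_mem hn hu, zero_mul]

omit hn in
/-- [folklore] The `n`-block has `n^{d+1}` sites. -/
theorem card_blockSitesF (n : ℕ) (Y : Site (d + 1)) : (blockSitesF n Y).card = n ^ (d + 1) := by
  rw [blockSitesF, Fintype.card_piFinset]
  have e : ∀ j : Fin (d + 1), (Finset.Icc ((n : ℤ) * Y j) ((n : ℤ) * Y j + n - 1)).card = n := by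
    intro j
    rw [Int.card_Icc]
    have : (n : ℤ) * Y j + n - 1 + 1 - (n : ℤ) * Y j = n := by ring
    rw [this, Int.toNat_natCast]
  simp only [e, Finset.prod_const, Finset.card_univ, Fintype.card_fin]

omit hn in
/-- [folklore] The face neighbourhood has at most `2·n^{d+1}` sites. -/
theorem card_bondNbhd_le (n : ℕ) (Y : Site (d + 1)) (κ' : Fin (d + 1)) : ((bondNbhd n Y κ').card : ℝ) ≤ 2 * (n : ℝ) ^ (d + 1) := by
  classical
  have h : (bondNbhd n Y κ').card ≤ 2 * n ^ (d + 1) := by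
    calc (bondNbhd n Y κ').card ≤ (blockSitesF n Y).card + ((blockSitesF n Y).image fun u => u - unitVec κ').card := Finset.card_union_le _ _
      _ ≤ (blockSitesF n Y).card + (blockSitesF n Y).card := Nat.add_le_add_left Finset.card_image_le _
      _ = 2 * n ^ (d + 1) := by rw [card_blockSitesF]; ring
  exact_mod_cast h

/-- [folklore] **A site of the face neighbourhood of the block of `x` is within `ℓ¹`-distance `(d+1)·n` of `x`.** -/
theorem l1_le_of_mem_bondNbhd {x u : Site (d + 1)} {κ' : Fin (d + 1)} (hu : u ∈ bondNbhd n (blk n x) κ') : l1 (u - x) ≤ ((d + 1 : ℕ) : ℝ) * n := by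
  classical
  have hcoord : ∀ j : Fin (d + 1), |((u - x) j : ℝ)| ≤ n := by
    intro j
    have hx1 := le_of_blk hn x j
    have hx2 := lt_of_blk hn x j
    have hb : ∀ w ∈ blockSitesF n (blk n x), (n : ℤ) * blk n x j ≤ w j ∧ w j ≤ (n : ℤ) * blk n x j + n - 1 := by
      intro w hw
      rw [blockSitesF, Fintype.mem_piFinset] at hw
      exact Finset.mem_Icc.1 (hw j)
    have hz : |u j - x j| ≤ (n : ℤ) := by
      rw [bondNbhd, Finset.mem_union, Finset.mem_image] at hu
      rcases hu with hu | ⟨w, hw, rfl⟩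
      · obtain ⟨h1, h2⟩ := hb u hu
        rw [abs_le]; constructor <;> omega
      · obtain ⟨h1, h2⟩ := hb w hw
        rw [Pi.sub_apply, unitVec_apply, abs_le]
        split_ifs <;> constructor <;> omega
    have : ((u - x) j : ℝ) = ((u j - x j : ℤ) : ℝ) := by simp
    rw [this, ← Int.cast_abs]
    exact_mod_cast hz
  calc l1 (u - x) = ∑ j : Fin (d + 1), |((u - x) j : ℝ)| := rfl
    _ ≤ ∑ _j : Fin (d + 1), (n : ℝ) := Finset.sum_le_sum fun j _ => hcoord j
    _ = ((d + 1 : ℕ) : ℝ) * n := by rw [Finset.sum_const, Finset.card_univ, Fintype.card_fin, nsmul_eq_mul]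

end Nbhd

/-- [our object] **THE SIGNED FACE SUM OF A (module-valued) BOND FAMILY OVER THE `n`-BLOCK `Y`**: `faceSum n T Y := Σ_{κ′} Σ_{u ∈ bondNbhd n Y κ′} gaugeWt n Y κ′ u • T κ′ u` — the entries on the
fine bonds ENTERING the block minus those LEAVING it (`gaugeWt ∈ {0, ±1}`); depends on the block only (scalar families `E = ℝ` and stencil families `E = MKer (d+1) (Fib d)` at once). -/
def faceSum {E : Type*} [AddCommGroup E] [Module ℝ E] (n : ℕ) (T : Fin (d + 1) → Site (d + 1) → E) (Y : Site (d + 1)) : E :=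
  ∑ κ' : Fin (d + 1), ∑ u ∈ bondNbhd n Y κ', gaugeWt n Y κ' u • T κ' u

/-- [folklore] `faceSum` unfolds. -/
theorem faceSum_apply {E : Type*} [AddCommGroup E] [Module ℝ E] (n : ℕ) (T : Fin (d + 1) → Site (d + 1) → E) (Y : Site (d + 1)) :
    faceSum n T Y = ∑ κ' : Fin (d + 1), ∑ u ∈ bondNbhd n Y κ', gaugeWt n Y κ' u • T κ' u := rfl

/-- [folklore] **THE FACE SUM AS ONE `Finset`-INDEXED COMBINATION** (index `⟨κ′, u⟩ ∈ univ.sigma (bondNbhd n Y)`, coefficients `gaugeWt n Y κ′ u ∈ {0, ±1}`) — the shape road lanes price by term. -/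
theorem faceSum_eq_sum_sigma {E : Type*} [AddCommGroup E] [Module ℝ E] (n : ℕ) (T : Fin (d + 1) → Site (d + 1) → E) (Y : Site (d + 1)) :
    faceSum n T Y = ∑ s ∈ (Finset.univ : Finset (Fin (d + 1))).sigma (bondNbhd n Y), gaugeWt n Y s.1 s.2 • T s.1 s.2 := by
  rw [faceSum, Finset.sum_sigma]

/-- [folklore] `faceSum` of the zero family vanishes. -/
theorem faceSum_zero {E : Type*} [AddCommGroup E] [Module ℝ E] (n : ℕ) (Y : Site (d + 1)) : faceSum n (0 : Fin (d + 1) → Site (d + 1) → E) Y = 0 := by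
  simp only [faceSum, Pi.zero_apply, smul_zero, Finset.sum_const_zero]

/-- [folklore] Evaluation commutes with the face sum (stencil families). -/
theorem faceSum_apply_kernel (n : ℕ) (S : Fin (d + 1) → Site (d + 1) → MKer (d + 1) (Fib d)) (Y p q : Site (d + 1)) (a b : Fib d) :
    faceSum n S Y p q a b = faceSum n (fun κ u => S κ u p q a b) Y := by
  simp only [faceSum, Finset.sum_apply, Pi.smul_apply, smul_eq_mul]

/-- [our object] **THE SLOT TRANSPORT `Ψ_Sᵀ` ON (module-valued) BOND FAMILIES**: `slotPsiS r n T α x := T α x + faceWt r n α x • faceSum n T (blk n x)` — the raw entry plus the face weight of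
the slot bond times its block's signed FACE SUM (`T + T^face`). -/
def slotPsiS {E : Type*} [AddCommGroup E] [Module ℝ E] (r : Fin (d + 1) → ℕ) (n : ℕ) (T : Fin (d + 1) → Site (d + 1) → E) :
    Fin (d + 1) → Site (d + 1) → E :=
  fun α x => T α x + faceWt r n α x • faceSum n T (blk n x)

/-- [folklore] `slotPsiS` unfolds. -/
theorem slotPsiS_apply {E : Type*} [AddCommGroup E] [Module ℝ E] (r : Fin (d + 1) → ℕ) (n : ℕ) (T : Fin (d + 1) → Site (d + 1) → E)
    (α : Fin (d + 1)) (x : Site (d + 1)) :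
    slotPsiS r n T α x = T α x + faceWt r n α x • ∑ κ' : Fin (d + 1), ∑ u ∈ bondNbhd n (blk n x) κ', gaugeWt n (blk n x) κ' u • T κ' u := rfl

/-- [folklore] **BLOCK-INDEXED FORM** (the shape of road «BF-x»'s packed lanes, gan24-leaf-05 g58 «FACE-PACK» `hS′`): for `b ∈ box`, at the site `n•y′ + b` of block `y′`,
`slotPsiS r n T κ (n•y′ + b) = T κ (n•y′ + b) + faceWt r n κ (n•y′ + b) • faceSum n T y′` — ONE block-dependent combination `faceSum n T y′`, weighted per slot bond. -/
theorem slotPsiS_block {E : Type*} [AddCommGroup E] [Module ℝ E] (r : Fin (d + 1) → ℕ) (n : ℕ) (T : Fin (d + 1) → Site (d + 1) → E) (κ : Fin (d + 1))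
    (y' : Site (d + 1)) {b : Fin (d + 1) → ℕ} (hb : b ∈ box (d + 1) n) :
    slotPsiS r n T κ ((n : ℤ) • y' + toSite b) = T κ ((n : ℤ) • y' + toSite b) + faceWt r n κ ((n : ℤ) • y' + toSite b) • faceSum n T y' := by
  rw [slotPsiS, blk_block y' hb]

/-- [folklore] `slotPsiS` of the zero family vanishes. -/
theorem slotPsiS_zero {E : Type*} [AddCommGroup E] [Module ℝ E] (r : Fin (d + 1) → ℕ) (n : ℕ) : slotPsiS r n (0 : Fin (d + 1) → Site (d + 1) → E) = 0 := by
  funext α x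
  rw [slotPsiS, faceSum_zero, smul_zero, add_zero]

/-- [folklore] **EVALUATION COMMUTES WITH THE SLOT TRANSPORT**: for a stencil family `S`, `(slotPsiS S α x) p q a b = slotPsiS (κ u ↦ S κ u p q a b) α x`. -/
theorem slotPsiS_apply_kernel (r : Fin (d + 1) → ℕ) (n : ℕ) (S : Fin (d + 1) → Site (d + 1) → MKer (d + 1) (Fib d)) (α : Fin (d + 1))
    (x p q : Site (d + 1)) (a b : Fib d) :
    slotPsiS r n S α x p q a b = slotPsiS r n (fun κ u => S κ u p q a b) α x := by
  simp only [slotPsiS, faceSum, Pi.add_apply, Pi.smul_apply, Finset.sum_apply, smul_eq_mul]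

section SlotSum

variable {n : ℕ} (hn : 0 < n) {r : Fin (d + 1) → ℕ} (hr : r ∈ box (d + 1) n)
include hn hr

/-- [folklore] The column `(Ψ_S e_{(α,x)})_{κ′}(·)` is supported in `insert x (bondNbhd n (blk x) κ′)`. -/
theorem corrPsiS_indR_eq_zero_of_not_mem {α κ' : Fin (d + 1)} {x u : Site (d + 1)} (hu : u ∉ insert x (bondNbhd n (blk n x) κ')) :
    corrPsiS (toSite r) n (indR α x) κ' u = 0 := by
  classical
  rw [Finset.mem_insert, not_or] at hu
  rw [corrPsiS_indR_apply hn hr, indR_apply, if_neg (fun h => hu.1 h.2), gaugeWt_eq_zero_of_not_mem hn hu.2, mul_zero, add_zero]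

/-- [folklore] **THE FACE SUM OF A COLUMN OF `Ψ_S` AGAINST A BOND FAMILY**: `Σ_{κ′} Σ'_u (Ψ_S e_{(α,x)})_{κ′}(u) · T κ′ u = slotPsiS r n T α x` (every series is a finite sum). -/
theorem sum_tsum_corrPsiS_indR_mul (T : Form1 (d + 1) ℝ) (α : Fin (d + 1)) (x : Site (d + 1)) :
    ∑ κ' : Fin (d + 1), ∑' u, corrPsiS (toSite r) n (indR α x) κ' u * T κ' u = slotPsiS r n T α x := by
  classical
  have step : ∀ κ' : Fin (d + 1), ∑' u, corrPsiS (toSite r) n (indR α x) κ' u * T κ' u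
      = (if κ' = α then T κ' x else 0) + faceWt r n α x * ∑ u ∈ bondNbhd n (blk n x) κ', gaugeWt n (blk n x) κ' u * T κ' u := by
    intro κ'
    have e : ∀ u, corrPsiS (toSite r) n (indR α x) κ' u * T κ' u
        = (if κ' = α ∧ u = x then T κ' u else 0) + faceWt r n α x * (gaugeWt n (blk n x) κ' u * T κ' u) := by
      intro u
      rw [corrPsiS_indR_apply hn hr, indR_apply]
      split_ifs <;> ring
    have hs1 : Summable fun u => (if κ' = α ∧ u = x then T κ' u else 0) :=
      summable_of_ne_finset_zero (s := {x}) fun u hu => by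
        rw [Finset.mem_singleton] at hu
        rw [if_neg fun h => hu h.2]
    have hs2 : Summable fun u => faceWt r n α x * (gaugeWt n (blk n x) κ' u * T κ' u) :=
      (summable_of_ne_finset_zero fun u hu => by rw [gaugeWt_eq_zero_of_not_mem hn hu, zero_mul]).mul_left _
    simp_rw [e]
    rw [hs1.tsum_add hs2, tsum_mul_left, tsum_gaugeWt_mul hn, tsum_eq_single x (fun u hu => if_neg fun h => hu h.2)]
    simp only [and_true]
  rw [Finset.sum_congr rfl fun κ' _ => step κ', Finset.sum_add_distrib, Finset.sum_ite_eq' Finset.univ α, if_pos (Finset.mem_univ _),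
    ← Finset.mul_sum, slotPsiS_apply, smul_eq_mul]
  simp only [smul_eq_mul]

end SlotSum

/-! ### Block-translation covariance of the slot transport -/

section Shift

variable {n : ℕ} (hn : 0 < n)
include hn

/-- [folklore] The pure-gauge weight is block-translation covariant: `gaugeWt n (Y + t) κ′ (u + n•t) = gaugeWt n Y κ′ u`. -/
theorem gaugeWt_add_block (Y t u : Site (d + 1)) (κ' : Fin (d + 1)) : gaugeWt n (Y + t) κ' (u + (n : ℤ) • t) = gaugeWt n Y κ' u := by
  rw [gaugeWt_eq, gaugeWt_eq, add_right_comm, blk_add_zsmul hn, blk_add_zsmul hn]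
  simp only [add_left_inj]

/-- [folklore] **THE FACE SUM IS BLOCK-TRANSLATION COVARIANT**: `Σ_{u ∈ bondNbhd (Y+t)} gaugeWt n (Y+t) κ′ u · g u = Σ_{u ∈ bondNbhd Y} gaugeWt n Y κ′ u · g (u + n•t)`. -/
theorem faceSum_shift (Y t : Site (d + 1)) (κ' : Fin (d + 1)) (g : Site (d + 1) → ℝ) :
    ∑ u ∈ bondNbhd n (Y + t) κ', gaugeWt n (Y + t) κ' u * g u = ∑ u ∈ bondNbhd n Y κ', gaugeWt n Y κ' u * g (u + (n : ℤ) • t) := by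
  rw [← tsum_gaugeWt_mul hn, ← tsum_gaugeWt_mul hn, ← (Equiv.addRight ((n : ℤ) • t)).tsum_eq]
  refine tsum_congr fun u => ?_
  rw [Equiv.coe_addRight, gaugeWt_add_block hn]

/-- [folklore] **BLOCK-TRANSLATION COVARIANCE OF THE SLOT TRANSPORT**: a block-covariant stencil family (`S κ (u + n•t) = shiftK (−n•t) (S κ u)`) has a block-covariant transport —
`slotPsiS r n S α (x + n•t) = shiftK (−n•t) (slotPsiS r n S α x)` (`faceWt_shift`, `faceSum_shift`); feed to `ResolventReflection.vertexOfK_translate_block`. -/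
theorem slotPsiS_shift (r : Fin (d + 1) → ℕ) {S : Fin (d + 1) → Site (d + 1) → MKer (d + 1) (Fib d)}
    (hS : ∀ κ u t, S κ (u + (n : ℤ) • t) = shiftK (-((n : ℤ) • t)) (S κ u)) (α : Fin (d + 1)) (x t : Site (d + 1)) :
    slotPsiS r n S α (x + (n : ℤ) • t) = shiftK (-((n : ℤ) • t)) (slotPsiS r n S α x) := by
  funext p q a b
  have eR : shiftK (-((n : ℤ) • t)) (slotPsiS r n S α x) p q a b = slotPsiS r n S α x (p + -((n : ℤ) • t)) (q + -((n : ℤ) • t)) a b := rfl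
  rw [eR, slotPsiS_apply_kernel, slotPsiS_apply_kernel, slotPsiS_apply, slotPsiS_apply, smul_eq_mul, smul_eq_mul, faceWt_shift hn,
    blk_add_zsmul hn, hS]
  simp only [smul_eq_mul]
  congr 2
  refine Finset.sum_congr rfl fun κ' _ => ?_
  rw [faceSum_shift hn]
  refine Finset.sum_congr rfl fun u _ => ?_
  rw [hS]; rfl

end Shift

end

end Summit.QuantumFields.BalabanUV.Beta.SymCorrectorFace
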